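import Literature.AlgebraicGeometry.Shioda1982.ExceptionalQuadruplesComplete
import HarnessLib

/-!
# Shioda 1982 / Meyer–Neutsch 1981: no exceptional quadruple at the level `N = 567` — kernel sweep, part 5 of 37

Topic `Literature/AlgebraicGeometry/Shioda1982`; companion of `ExceptionalQuadruplesComplete.lean` (search `checkB`, soundness
`tabelleOneCompleteAt_of_chunks`, invariant form `exists_mem_reps_of_isExceptionalQuadruple`, statement `TabelleOneCompleteAt`; sources,
method and framing in its module docstring) and of the series `ExceptionalQuadruplesSweep*.lean` (together: every level `2 ≤ N ≤ 180`
that is not a row of Tabelle 1; `…SweepTwoHundredTwenty/…TwoHundredSixty/…ThreeHundredForty.lean`,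
`…SweepTwoHundredFiftyTwo/…ThreeHundredNinetySix/…FourHundredSixtyEight.lean`, `…SweepTwoHundred.lean`: the levels `220, 260, 340`, `252, 396, 468`
and `200` of the families `20p`, `36p`, `40p`; `…Sweep<Level>[Part<K>].lean` for the `{2,3,5,7}`-smooth residual levels
`189, 192, 210, 216, 224, 240, 270, 288, 300, 315, 320, 324, 336, 360, 378, 384, 405, 420, 432, 448` and now `480 … 630`). THEOREMS only (no definition, no named fact): the same kernel
search at the single level `N = 567`, which carries NO row of [MeyerNeutsch1981Fermatquadrupel, Tabelle 1] (computer-generated there,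
"alle Fermatquadrupel für N ≤ 614 ermittelt", §2 p. 53) and lies above the range `N ≤ 180` of Shioda's table p. 727 — by Aoki's
Theorem C ([Aoki1983], computer-assisted for `181 ≤ m ≤ 672`) there is no exceptional element at any level `> 180`; the files
`ExceptionalQuadruplesSweepFiveHundredSixtySevenPartOne.lean`, `ExceptionalQuadruplesSweepFiveHundredSixtySevenPartTwo.lean`, `ExceptionalQuadruplesSweepFiveHundredSixtySevenPartThree.lean`, `ExceptionalQuadruplesSweepFiveHundredSixtySevenPartFour.lean`, `ExceptionalQuadruplesSweepFiveHundredSixtySevenPartFive.lean`, `ExceptionalQuadruplesSweepFiveHundredSixtySevenPartSix.lean`, `ExceptionalQuadruplesSweepFiveHundredSixtySevenPartSeven.lean`, `ExceptionalQuadruplesSweepFiveHundredSixtySevenPartEight.lean`, `ExceptionalQuadruplesSweepFiveHundredSixtySevenPartNine.lean`, `ExceptionalQuadruplesSweepFiveHundredSixtySevenPartTen.lean`, `ExceptionalQuadruplesSweepFiveHundredSixtySevenPartEleven.lean`, `ExceptionalQuadruplesSweepFiveHundredSixtySevenPartTwelve.lean`, `ExceptionalQuadruplesSweepFiveHundredSixtySevenPartThirteen.lean`,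 `ExceptionalQuadruplesSweepFiveHundredSixtySevenPartFourteen.lean`, `ExceptionalQuadruplesSweepFiveHundredSixtySevenPartFifteen.lean`, `ExceptionalQuadruplesSweepFiveHundredSixtySevenPartSixteen.lean`, `ExceptionalQuadruplesSweepFiveHundredSixtySevenPartSeventeen.lean`, `ExceptionalQuadruplesSweepFiveHundredSixtySevenPartEighteen.lean`, `ExceptionalQuadruplesSweepFiveHundredSixtySevenPartNineteen.lean`, `ExceptionalQuadruplesSweepFiveHundredSixtySevenPartTwenty.lean`, `ExceptionalQuadruplesSweepFiveHundredSixtySevenPartTwentyOne.lean`, `ExceptionalQuadruplesSweepFiveHundredSixtySevenPartTwentyTwo.lean`, `ExceptionalQuadruplesSweepFiveHundredSixtySevenPartTwentyThree.lean`, `ExceptionalQuadruplesSweepFiveHundredSixtySevenPartTwentyFour.lean`, `ExceptionalQuadruplesSweepFiveHundredSixtySevenPartTwentyFive.lean`, `ExceptionalQuadruplesSweepFiveHundredSixtySevenPartTwentySix.lean`, `ExceptionalQuadruplesSweepFiveHundredSixtySevenPartTwentySeven.lean`, `ExceptionalQuadruplesSweepFiveHundredSixtySevenPartTwentyEight.lean`,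 `ExceptionalQuadruplesSweepFiveHundredSixtySevenPartTwentyNine.lean`, `ExceptionalQuadruplesSweepFiveHundredSixtySevenPartThirty.lean`, `ExceptionalQuadruplesSweepFiveHundredSixtySevenPartThirtyOne.lean`, `ExceptionalQuadruplesSweepFiveHundredSixtySevenPartThirtyTwo.lean`, `ExceptionalQuadruplesSweepFiveHundredSixtySevenPartThirtyThree.lean`, `ExceptionalQuadruplesSweepFiveHundredSixtySevenPartThirtyFour.lean`, `ExceptionalQuadruplesSweepFiveHundredSixtySevenPartThirtyFive.lean`, `ExceptionalQuadruplesSweepFiveHundredSixtySevenPartThirtySix.lean`, `ExceptionalQuadruplesSweepFiveHundredSixtySeven.lean` make the instance `N = 567` a kernel statement. The search at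
`N = 567` visits 5103685 candidate triples (`φ(567) − 1 = 323` units each), too many for one elaboration of bounded wall time, so the
chunks of first entries are spread over 37 files: `ExceptionalQuadruplesSweepFiveHundredSixtySevenPartOne.lean` — first entries `0 ≤ a < 5` (134881 candidates);
`ExceptionalQuadruplesSweepFiveHundredSixtySevenPartTwo.lean` — first entries `5 ≤ a < 10` (137062 candidates);
`ExceptionalQuadruplesSweepFiveHundredSixtySevenPartThree.lean` — first entries `10 ≤ a < 15` (139014 candidates);
`ExceptionalQuadruplesSweepFiveHundredSixtySevenPartFour.lean` — first entries `15 ≤ a < 20` (140737 candidates);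
`ExceptionalQuadruplesSweepFiveHundredSixtySevenPartFive.lean` — first entries `20 ≤ a < 24` (113676 candidates);
`ExceptionalQuadruplesSweepFiveHundredSixtySevenPartSix.lean` — first entries `24 ≤ a < 29` (143261 candidates);
`ExceptionalQuadruplesSweepFiveHundredSixtySevenPartSeven.lean` — first entries `29 ≤ a < 34` (144342 candidates);
`ExceptionalQuadruplesSweepFiveHundredSixtySevenPartEight.lean` — first entries `34 ≤ a < 39` (145194 candidates);
`ExceptionalQuadruplesSweepFiveHundredSixtySevenPartNine.lean` — first entries `39 ≤ a < 43` (116615 candidates);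
`ExceptionalQuadruplesSweepFiveHundredSixtySevenPartTen.lean` — first entries `43 ≤ a < 48` (146150 candidates);
`ExceptionalQuadruplesSweepFiveHundredSixtySevenPartEleven.lean` — first entries `48 ≤ a < 53` (146361 candidates);
`ExceptionalQuadruplesSweepFiveHundredSixtySevenPartTwelve.lean` — first entries `53 ≤ a < 58` (146342 candidates);
`ExceptionalQuadruplesSweepFiveHundredSixtySevenPartThirteen.lean` — first entries `58 ≤ a < 62` (116906 candidates);
`ExceptionalQuadruplesSweepFiveHundredSixtySevenPartFourteen.lean` — first entries `62 ≤ a < 67` (145731 candidates);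
`ExceptionalQuadruplesSweepFiveHundredSixtySevenPartFifteen.lean` — first entries `67 ≤ a < 72` (145070 candidates);
`ExceptionalQuadruplesSweepFiveHundredSixtySevenPartSixteen.lean` — first entries `72 ≤ a < 77` (144181 candidates);
`ExceptionalQuadruplesSweepFiveHundredSixtySevenPartSeventeen.lean` — first entries `77 ≤ a < 81` (114550 candidates);
`ExceptionalQuadruplesSweepFiveHundredSixtySevenPartEighteen.lean` — first entries `81 ≤ a < 86` (142002 candidates);
`ExceptionalQuadruplesSweepFiveHundredSixtySevenPartNineteen.lean` — first entries `86 ≤ a < 91` (140471 candidates);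
`ExceptionalQuadruplesSweepFiveHundredSixtySevenPartTwenty.lean` — first entries `91 ≤ a < 96` (138710 candidates);
`ExceptionalQuadruplesSweepFiveHundredSixtySevenPartTwentyOne.lean` — first entries `96 ≤ a < 101` (136721 candidates);
`ExceptionalQuadruplesSweepFiveHundredSixtySevenPartTwentyTwo.lean` — first entries `101 ≤ a < 106` (134502 candidates);
`ExceptionalQuadruplesSweepFiveHundredSixtySevenPartTwentyThree.lean` — first entries `106 ≤ a < 112` (158151 candidates);
`ExceptionalQuadruplesSweepFiveHundredSixtySevenPartTwentyFour.lean` — first entries `112 ≤ a < 117` (128814 candidates);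
`ExceptionalQuadruplesSweepFiveHundredSixtySevenPartTwentyFive.lean` — first entries `117 ≤ a < 122` (125862 candidates);
`ExceptionalQuadruplesSweepFiveHundredSixtySevenPartTwentySix.lean` — first entries `122 ≤ a < 128` (146815 candidates);
`ExceptionalQuadruplesSweepFiveHundredSixtySevenPartTwentySeven.lean` — first entries `128 ≤ a < 134` (141838 candidates);
`ExceptionalQuadruplesSweepFiveHundredSixtySevenPartTwentyEight.lean` — first entries `134 ≤ a < 140` (136465 candidates);
`ExceptionalQuadruplesSweepFiveHundredSixtySevenPartTwentyNine.lean` — first entries `140 ≤ a < 146` (130696 candidates);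
`ExceptionalQuadruplesSweepFiveHundredSixtySevenPartThirty.lean` — first entries `146 ≤ a < 153` (144659 candidates);
`ExceptionalQuadruplesSweepFiveHundredSixtySevenPartThirtyOne.lean` — first entries `153 ≤ a < 160` (135639 candidates);
`ExceptionalQuadruplesSweepFiveHundredSixtySevenPartThirtyTwo.lean` — first entries `160 ≤ a < 168` (143164 candidates);
`ExceptionalQuadruplesSweepFiveHundredSixtySevenPartThirtyThree.lean` — first entries `168 ≤ a < 177` (144827 candidates);
`ExceptionalQuadruplesSweepFiveHundredSixtySevenPartThirtyFour.lean` — first entries `177 ≤ a < 187` (139193 candidates);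
`ExceptionalQuadruplesSweepFiveHundredSixtySevenPartThirtyFive.lean` — first entries `187 ≤ a < 199` (134857 candidates);
`ExceptionalQuadruplesSweepFiveHundredSixtySevenPartThirtySix.lean` — first entries `199 ≤ a < 216` (135809 candidates);
`ExceptionalQuadruplesSweepFiveHundredSixtySeven.lean` — first entries `216 ≤ a < 567` (144417 candidates); the last one assembles
`completeAt_fiveHundredSixtySeven` (every sorted pair-free primitive Hodge 4-multiset mod `567` is standard) and `not_isExceptionalQuadruple_fiveHundredSixtySeven`.
WHY THIS LEVEL (cell `pub-hfermat`): `567 = 3⁴·7`: the tree's character-sum families cover the levels `K·p`, `p` a prime above a bound depending on `K`, for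
`K ∈ {2, 3, 4, 6, 8, 9, 10, 12, 18, 20, 24, 36, 40}` or `K` a power of `2` or of `3` (`PicardNumber<K>Prime.lean`, `PicardNumberTwoPowerPrime.lean`,
`PicardNumberThreePowPrime.lean`) and the prime-power levels (`PicardNumberPrimePower.lean`); writing `567 = K·p` with `p` prime forces
`K ∈ {81, 189}`; `K = 81 = 3⁴` with `p = 7` is below the range `p ≥ 11` of `exceptional_threePowPrime`, the other is not among those `K`. `decide +kernel` only (no `native_decide`).

HONEST FRAMING (cell `pub-hfermat`): explicit algebraic cycles for specific Hodge classes on Fermat/Delsarte varieties; residual open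
instances listed; no claim on general Hodge. These classes are algebraic (Lefschetz (1,1)); certified here is only the emptiness of the
exceptional list at this level.

## References
* [MeyerNeutsch1981Fermatquadrupel] W. Meyer, W. Neutsch, *Fermatquadrupel*, Math. Ann. 256 (1981) 51–62, §2 p. 53, Tabelle 1 p. 54 (no row 567).
* [Shioda1982PicardFermat] T. Shioda, J. Fac. Sci. Univ. Tokyo IA 28 (1982) 725–734, table p. 727 (levels `≤ 180`), Prop. 4 (Q′) p. 729.
* [Aoki1983] N. Aoki, Math. Ann. 266 (1983) 23–54, Thm. C.
-/

namespace Literature.AlgebraicGeometry.Shioda1982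

open Literature.AlgebraicGeometry.HodgeTheory

set_option maxHeartbeats 0 in
/-- **The search at `N = 567` passes on the first entries `20 ≤ a < 24`** (part 5 of 37: 4 chunks, 113676 candidate
triples): every visited sorted quadruple of representatives there fails the Hodge test or is standard (`checkB`; `reps 567 = []`).
[cite: MeyerNeutsch1981Fermatquadrupel, §2 p. 53 ("alle Fermatquadrupel für N ≤ 614 ermittelt") and Tabelle 1 p. 54 (no row 567)]
[cite: Aoki1983, Thm. C] -/
theorem checkB_fiveHundredSixtySeven_partFive :
    ∀ p ∈ ([(20, 1), (21, 1), (22, 1), (23, 1)] : List (ℕ × ℕ)), checkB 567 p.1 p.2 = true := by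
  intro p hp
  simp only [List.mem_cons, List.not_mem_nil, or_false] at hp
  rcases hp with rfl | rfl | rfl | rfl <;> decide +kernel

end Literature.AlgebraicGeometry.Shioda1982
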